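import Mathlib
import HarnessLib
import Literature.Analysis.FluidPDE.Tao2016AveragedNS.TaylorChainCertificate
import Summits.NavierStokesRegularity.NavierStokesRegularity.Theorems.TaylorModelRungThreeReadoutChainTools
import Summits.NavierStokesRegularity.NavierStokesRegularity.Theorems.TaylorModelRungThreeReadoutG3Base

/-!
# Line `taylor-model` on crux K1b-DR (stmt-NavierStokesRegularity-23954) — stub G4 (`LandingC1`),
# helper 1: the certificate clauses used by the landing read-out, projected out of `Valid`

Toward the registered stub `stub_landing : LandingC1` of skeleton v4 (`a500375dfcc940c7`, line owner
ns-idea-2 g3; tree statement `…ReadoutStubDefs.LandingC1`, p597090). `CertData.Valid` is a conjunction of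
four long predicates (`Static`, `StageNumerics`, `Chain`, `Readouts`); this file only NAMES the individual
clauses the G4 proof consumes, as projections `G4.xxx (hV : cd.Valid) (hj : j ≤ cd.N₀) …`, so that the
analytic files downstream never destructure the record again (projections already landed by the sibling stub G3,
`…ReadoutG3Base`: `G3.omega_pos`, `G3.kappa_pos`, `G3.h_pos`, `G3.Tn_succ`, `G3.rP_nonneg`, `G3.isLinearMap_Cm/Ci`,
`G3.frame_wsupp`, `G3.para_inBall`, `G3.NCi_clause`, … are imported, not restated). Nothing is asserted beyond
`Valid` itself.

MODEL-lattice bookkeeping only (rung TL-M3 of the NS ladder); nothing here is a statement about the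
Navier–Stokes equations.
-/

noncomputable section

-- the sub-problem namespace repeats the summit name by design (D-0017)
set_option linter.dupNamespace false

namespace Summit.NavierStokesRegularity.NavierStokesRegularity.Theorems.TaylorModelReadout.G4

open scoped BigOperators
open Set Finset Literature.Analysis.FluidPDE.TaoCascade Literature.Analysis.FluidPDE.TaoCascade.TaylorChain

variable {cd : CertData} {j : ℕ}

/-! ### Static and per-stage numerics -/

/-- The shell `1` lies in the window. [folklore] -/
theorem one_mem_window (hV : cd.Valid) : -cd.Kb ≤ (1 : ℤ) ∧ (1 : ℤ) ≤ cd.Ka :=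
  ⟨by linarith [G3.Kb_nonneg hV], G3.one_le_Ka hV⟩

/-- `nx j ≤ N₀` (StageNumerics). [folklore] -/
theorem nx_le (hV : cd.Valid) (hj : j ≤ cd.N₀) : cd.nx j ≤ cd.N₀ := (hV.2.1.1 j hj).1

/-- `1 ≤ Lv j` (StageNumerics). [folklore] -/
theorem one_le_Lv (hV : cd.Valid) (hj : j ≤ cd.N₀) : 1 ≤ cd.Lv j := (hV.2.1.1 j hj).2.1

/-- The front-amplitude clause `2^(-θ) Lv (nx j) ≤ as j − Λ δ τs ω j 1` (StageNumerics). [folklore] -/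
theorem as_clause (hV : cd.Valid) (hj : j ≤ cd.N₀) :
    (2:ℝ) ^ (-cd.θ) * cd.Lv (cd.nx j) ≤ cd.as j - cd.Λ j * cd.δ j * cd.τs * cd.ω j 1 :=
  (hV.2.1.1 j hj).2.2.2.2.2.2.2.2.1

/-- `0 < as j`. [folklore] -/
theorem as_pos (hV : cd.Valid) (hj : j ≤ cd.N₀) : 0 < cd.as j := by
  have h1 := as_clause hV hj
  have h2 : 1 ≤ cd.Lv (cd.nx j) := one_le_Lv hV (nx_le hV hj)
  have h3 : 0 < (2:ℝ) ^ (-cd.θ) := Real.rpow_pos_of_pos (by norm_num) _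
  have h4 : 0 ≤ cd.Λ j * cd.δ j * cd.τs * cd.ω j 1 :=
    mul_nonneg (mul_nonneg (mul_nonneg (G3.Lambda_nonneg hV hj) (G3.delta_nonneg hV hj)) (G3.taus_pos hV).le)
      (G3.omega_pos hV hj 1).le
  nlinarith

/-- The weighted bilinear bound (B) of the polarised truncated field. [folklore] -/
theorem Qb_bound (hV : cd.Valid) (hj : j ≤ cd.N₀) :
    ∀ (u v : Fin 4 → ℤ → ℝ) (Nu Nv : ℝ), 0 ≤ Nu → 0 ≤ Nv → cd.InBall j u Nu → cd.InBall j v Nv →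
      cd.InBall j (cd.Qb u v) (cd.bb j * Nu * Nv) := (hV.2.1.2 j hj).2

/-! ### Chain: stage-level clauses -/

/-- `S j - 1 < S j`. [folklore] -/
theorem S_sub_one_lt (hV : cd.Valid) (hj : j ≤ cd.N₀) : cd.S j - 1 < cd.S j :=
  Nat.sub_lt (G3.one_le_S hV hj) Nat.one_pos

/-- The base point `x j 0` lies in the entry polytope. [folklore] -/
theorem inPoly_x0 (hV : cd.Valid) (hj : j ≤ cd.N₀) : InPoly cd j (cd.x j 0) := (hV.2.2.1 j hj).2.2.2.2.1

/-- Entry clause: every polytope point is `x 0 + Cm 0 ξ + e` with `|ξ| ≤ rP 0`, `e ∈ Ball(E 0)`, and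
`Cm 0 ξ + e ∈ Ball(dm)`. [folklore] -/
theorem entry (hV : cd.Valid) (hj : j ≤ cd.N₀) {q : Fin 4 → ℤ → ℝ} (hq : InPoly cd j q) :
    ∃ ξ e : (Fin 4 → ℤ → ℝ), (∀ i k, -cd.Kb ≤ k → k ≤ cd.Ka → |ξ i k| ≤ cd.rP j 0 i k ∧
      q i k = cd.x j 0 i k + cd.Cm j 0 ξ i k + e i k) ∧ cd.InBall j e (cd.E j 0) ∧
      cd.InBall j (cd.Cm j 0 ξ + e) (cd.dm j) := (hV.2.2.1 j hj).2.2.2.2.2.1 q hq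

/-- `q − x j 0 ∈ Ball(dm)` (window components) for every polytope point `q`. [folklore] -/
theorem inBall_sub_x0 (hV : cd.Valid) (hj : j ≤ cd.N₀) {q : Fin 4 → ℤ → ℝ} (hq : InPoly cd j q) :
    cd.InBall j (q - cd.x j 0) (cd.dm j) := by
  obtain ⟨ξ, e, h1, -, h3⟩ := entry hV hj hq
  intro i k hk1 hk2
  have h := (h1 i k hk1 hk2).2
  have : (q - cd.x j 0) i k = (cd.Cm j 0 ξ + e) i k := by
    simp only [Pi.sub_apply, Pi.add_apply]; linarith
  rw [this]; exact h3 i k hk1 hk2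

/-- `0 ≤ dm j`. [folklore] -/
theorem dm_nonneg (hV : cd.Valid) (hj : j ≤ cd.N₀) : 0 ≤ cd.dm j := by
  have h := inBall_sub_x0 hV hj (inPoly_x0 hV hj) cd.i₀ 1 (one_mem_window hV).1 (one_mem_window hV).2
  have hω := G3.omega_pos hV hj 1
  have : 0 ≤ cd.dm j * cd.ω j 1 := (abs_nonneg _).trans h
  nlinarith

/-! ### Chain: per-node clauses (`s' ≤ S j`) -/

section Node

variable {s : ℕ}

/-- The centre `x j s` is window-supported. [folklore] -/
theorem wsupp_x (hV : cd.Valid) (hj : j ≤ cd.N₀) (hs : s ≤ cd.S j) : cd.Wsupp (cd.x j s) := ((hV.2.2.1 j hj).2.2.2.2.2.2.1 s hs).1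

/-- `0 ≤ mC j s`. [folklore] -/
theorem mC_nonneg (hV : cd.Valid) (hj : j ≤ cd.N₀) (hs : s ≤ cd.S j) : 0 ≤ cd.mC j s := ((hV.2.2.1 j hj).2.2.2.2.2.2.1 s hs).2.2.1

/-- `x j s ∈ Ball(mC j s)`. [folklore] -/
theorem inBall_x (hV : cd.Valid) (hj : j ≤ cd.N₀) (hs : s ≤ cd.S j) : cd.InBall j (cd.x j s) (cd.mC j s) := ((hV.2.2.1 j hj).2.2.2.2.2.2.1 s hs).2.2.2.1

/-- `E j s ≤ EO j s`. [folklore] -/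
theorem E_le_EO (hV : cd.Valid) (hj : j ≤ cd.N₀) (hs : s ≤ cd.S j) : cd.E j s ≤ cd.EO j s := ((hV.2.2.1 j hj).2.2.2.2.2.2.1 s hs).2.2.2.2.2.2.2.1

/-- `EO j s ≤ ρO j s`. [folklore] -/
theorem EO_le_ρO (hV : cd.Valid) (hj : j ≤ cd.N₀) (hs : s ≤ cd.S j) : cd.EO j s ≤ cd.ρO j s := ((hV.2.2.1 j hj).2.2.2.2.2.2.1 s hs).2.2.2.2.2.2.2.2.1

/-- `E j s ≤ ρ j s`. [folklore] -/
theorem E_le_ρ (hV : cd.Valid) (hj : j ≤ cd.N₀) (hs : s ≤ cd.S j) : cd.E j s ≤ cd.ρ j s := ((hV.2.2.1 j hj).2.2.2.2.2.2.1 s hs).2.2.2.2.2.2.2.2.2.1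

/-- `ρ j s ≤ ρO j s`. [folklore] -/
theorem ρ_le_ρO (hV : cd.Valid) (hj : j ≤ cd.N₀) (hs : s ≤ cd.S j) : cd.ρ j s ≤ cd.ρO j s := ((hV.2.2.1 j hj).2.2.2.2.2.2.1 s hs).2.2.2.2.2.2.2.2.2.2.1

/-- `0 ≤ EI j s`. [folklore] -/
theorem EI_nonneg (hV : cd.Valid) (hj : j ≤ cd.N₀) (hs : s ≤ cd.S j) : 0 ≤ cd.EI j s := ((hV.2.2.1 j hj).2.2.2.2.2.2.1 s hs).2.2.2.2.2.1

/-- `EI j s ≤ E j s`. [folklore] -/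
theorem EI_le_E (hV : cd.Valid) (hj : j ≤ cd.N₀) (hs : s ≤ cd.S j) : cd.EI j s ≤ cd.E j s := ((hV.2.2.1 j hj).2.2.2.2.2.2.1 s hs).2.2.2.2.2.2.1

/-- `P j s 0 = x j s`. [folklore] -/
theorem P_zero (hV : cd.Valid) (hj : j ≤ cd.N₀) (hs : s ≤ cd.S j) : cd.P j s 0 = cd.x j s :=
  ((hV.2.2.1 j hj).2.2.2.2.2.2.1 s hs).2.2.2.2.2.2.2.2.2.2.2.2.2.2.2.2.1

/-- The Taylor recursion of `P j s`. [folklore] -/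
theorem P_rec (hV : cd.Valid) (hj : j ≤ cd.N₀) (hs : s ≤ cd.S j) : ∀ n, n < cd.pdeg → ∀ i k, ((n : ℝ) + 1) * cd.P j s (n + 1) i k =
    ∑ m' ∈ Finset.range (n + 1), cd.Qb (cd.P j s m') (cd.P j s (n - m')) i k :=
  ((hV.2.2.1 j hj).2.2.2.2.2.2.1 s hs).2.2.2.2.2.2.2.2.2.2.2.2.2.2.2.2.2.1

/-- `Wv j s 0` is the window truncation. [folklore] -/
theorem Wv_zero (hV : cd.Valid) (hj : j ≤ cd.N₀) (hs : s ≤ cd.S j) : ∀ (v : Fin 4 → ℤ → ℝ) i k,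
    cd.Wv j s 0 v i k = if -cd.Kb ≤ k ∧ k ≤ cd.Ka then v i k else 0 :=
  ((hV.2.2.1 j hj).2.2.2.2.2.2.1 s hs).2.2.2.2.2.2.2.2.2.2.2.2.2.2.2.2.2.2.1

/-- The variational recursion of `Wv j s`. [folklore] -/
theorem Wv_rec (hV : cd.Valid) (hj : j ≤ cd.N₀) (hs : s ≤ cd.S j) : ∀ n, n < cd.pdeg → ∀ (v : Fin 4 → ℤ → ℝ) i k, ((n : ℝ) + 1) * cd.Wv j s (n + 1) v i k =
    ∑ m' ∈ Finset.range (n + 1), (cd.Qb (cd.P j s m') (cd.Wv j s (n - m') v) i k +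
      cd.Qb (cd.Wv j s (n - m') v) (cd.P j s m') i k) :=
  ((hV.2.2.1 j hj).2.2.2.2.2.2.1 s hs).2.2.2.2.2.2.2.2.2.2.2.2.2.2.2.2.2.2.2

/-- Jet identification: `P j s n` read in window coordinates is the Taylor jet of `Qw`. [folklore] -/
theorem toVec_P (hV : cd.Valid) (hj : j ≤ cd.N₀) (hs : s ≤ cd.S j) : ∀ n, n ≤ cd.pdeg → toVec cd (cd.P j s n) = taylorJet (Qw cd) (toVec cd (cd.x j s)) n :=
  toVec_table_eq_taylorJet (P_zero hV hj hs) (P_rec hV hj hs)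

end Node

/-! ### Chain: per-sub-step clauses (`s' < S j`) -/

section Step

variable {s : ℕ}

/-- Guard `bb · mC · h < 1`. [folklore] -/
theorem guard_mC (hV : cd.Valid) (hj : j ≤ cd.N₀) (hs : s < cd.S j) : cd.bb j * cd.mC j s * cd.h j s < 1 := ((hV.2.2.1 j hj).2.2.2.2.2.2.2 s hs).2.1

/-- Guard `bb · (mC + ρO) · h < 1`. [folklore] -/
theorem guard_ρO (hV : cd.Valid) (hj : j ≤ cd.N₀) (hs : s < cd.S j) : cd.bb j * (cd.mC j s + cd.ρO j s) * cd.h j s < 1 :=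
  ((hV.2.2.1 j hj).2.2.2.2.2.2.2 s hs).2.2.1

/-- `TP j s u ∈ Ball(mT j s)` for `u ∈ [0, h]`. [folklore] -/
theorem inBall_TP (hV : cd.Valid) (hj : j ≤ cd.N₀) (hs : s < cd.S j) : ∀ u ∈ Icc 0 (cd.h j s), cd.InBall j (cd.TP j s u) (cd.mT j s) :=
  ((hV.2.2.1 j hj).2.2.2.2.2.2.2 s hs).2.2.2.2.1

/-- `0 ≤ SpO j s`. [folklore] -/
theorem SpO_nonneg (hV : cd.Valid) (hj : j ≤ cd.N₀) (hs : s < cd.S j) : 0 ≤ cd.SpO j s := ((hV.2.2.1 j hj).2.2.2.2.2.2.2 s hs).2.2.2.2.2.1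

/-- κ-guard `bb · (mT + SpO + κ) · h < 1`. [folklore] -/
theorem guard_κ (hV : cd.Valid) (hj : j ≤ cd.N₀) (hs : s < cd.S j) : cd.bb j * (cd.mT j s + cd.SpO j s + cd.κ j) * cd.h j s < 1 :=
  ((hV.2.2.1 j hj).2.2.2.2.2.2.2 s hs).2.2.2.2.2.2.1

/-- `1/(1 − bb (mT+SpO+κ) h)^2 ≤ L1 j s`. [folklore] -/
theorem L1_clause (hV : cd.Valid) (hj : j ≤ cd.N₀) (hs : s < cd.S j) : 1 / (1 - cd.bb j * (cd.mT j s + cd.SpO j s + cd.κ j) * cd.h j s) ^ 2 ≤ cd.L1 j s :=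
  ((hV.2.2.1 j hj).2.2.2.2.2.2.2 s hs).2.2.2.2.2.2.2.1

/-- Parallelepiped transport: `Ci (s+1) (Vap s h (Cm s ξ))` stays in the next parallelepiped. [folklore] -/
theorem par_transport (hV : cd.Valid) (hj : j ≤ cd.N₀) (hs : s < cd.S j) : ∀ ξ : (Fin 4 → ℤ → ℝ), (∀ i k, -cd.Kb ≤ k → k ≤ cd.Ka → |ξ i k| ≤ cd.rP j s i k) →
    ∀ i k, -cd.Kb ≤ k → k ≤ cd.Ka →
      |cd.Ci j (s + 1) (cd.Vap j s (cd.h j s) (cd.Cm j s ξ)) i k| ≤ cd.rP j (s + 1) i k :=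
  ((hV.2.2.1 j hj).2.2.2.2.2.2.2 s hs).2.2.2.2.2.2.2.2.2.2.2.2.2.2.2.2.2.2.2.2.1

/-- The frame-adapted variation defect clause defining `κB j s`. [folklore] -/
theorem κB_clause (hV : cd.Valid) (hj : j ≤ cd.N₀) (hs : s < cd.S j) : cd.NCi j (s + 1) * (cd.RemV (cd.bb j) (cd.mC j s) (cd.h j s) +
    (1 / (1 - cd.bb j * (cd.mC j s + cd.ρO j s) * cd.h j s) ^ 2 - 1 / (1 - cd.bb j * cd.mC j s * cd.h j s) ^ 2)) *
      (cd.ρO j s - cd.EO j s) ≤ cd.κB j s :=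
  ((hV.2.2.1 j hj).2.2.2.2.2.2.2 s hs).2.2.2.2.2.2.2.2.2.2.2.2.2.2.2.2.2.2.2.2.2.1

end Step

/-! ### Readouts -/

section Readouts

/-- `0 < γ j`. [folklore] -/
theorem γ_pos (hV : cd.Valid) (hj : j ≤ cd.N₀) : 0 < cd.γ j := (hV.2.2.2 j hj).2.1

/-- The section functional is bounded by `Nσ j` on the unit ball. [folklore] -/
theorem σf_bound (hV : cd.Valid) (hj : j ≤ cd.N₀) : ∀ v : (Fin 4 → ℤ → ℝ), cd.InBall j v 1 → |cd.σf j v| ≤ cd.Nσ j := (hV.2.2.2 j hj).2.2.1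

/-- Transversality `γ ≤ σf (Qb y y)` on the last sub-step's E-level in-step enclosure. [folklore] -/
theorem transversal (hV : cd.Valid) (hj : j ≤ cd.N₀) : ∀ u ∈ Icc 0 (cd.h j (cd.S j - 1)), ∀ w' : (Fin 4 → ℤ → ℝ),
    cd.InBall j w' (cd.Sp j (cd.S j - 1)) →
      cd.γ j ≤ cd.σf j (cd.Qb (cd.TP j (cd.S j - 1) u + w') (cd.TP j (cd.S j - 1) u + w')) :=
  (hV.2.2.2 j hj).2.2.2.2.2.1

/-- Crossing read-outs: front amplitude, behind-landing and the `landD` (C¹ landing) bound at every crossing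
state of the E-level enclosure. [folklore] -/
theorem crossing_readouts (hV : cd.Valid) (hj : j ≤ cd.N₀) : ∀ u ∈ Icc 0 (cd.h j (cd.S j - 1)), ∀ w' : (Fin 4 → ℤ → ℝ),
    cd.InBall j w' (cd.Sp j (cd.S j - 1)) → cd.σf j (cd.TP j (cd.S j - 1) u + w') = cd.lev j →
      cd.as j ≤ |(cd.TP j (cd.S j - 1) u + w') cd.i₀ 1| ∧
      (∀ i, |(cd.TP j (cd.S j - 1) u + w') i (-cd.Kb)| + cd.Λ j * cd.δ j * cd.τs * cd.ω j (-cd.Kb) ≤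
        (2:ℝ) ^ (-cd.θ) * (cd.Cb * (2:ℝ) ^ ((3:ℝ)/4 * ((cd.Kb:ℝ) + 1)))) ∧
      (∀ (v : Fin 4 → ℝ) (l : ℕ), (∀ i, |v i| ≤ Real.sqrt (10*cd.Cg*(2:ℝ) ^ (-(7:ℝ)*((cd.Ka:ℝ) + 1)))) →
        ∀ z : (Fin 4 → ℤ → ℝ), cd.InBall j z 1 →
          |cd.ℓ (cd.nx j) l (cd.landD j (cd.TP j (cd.S j - 1) u + w') v z)| ≤ cd.NDL j l) :=
  (hV.2.2.2 j hj).2.2.2.2.2.2.1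

/-- Base landing with C¹ allowance at every crossing state of the base-trajectory enclosure. [folklore] -/
theorem base_landing (hV : cd.Valid) (hj : j ≤ cd.N₀) : ∀ u ∈ Icc 0 (cd.h j (cd.S j - 1)), ∀ w' : (Fin 4 → ℤ → ℝ),
    cd.InBall j w' (cd.SpI j (cd.S j - 1)) → cd.σf j (cd.TP j (cd.S j - 1) u + w') = cd.lev j →
      ∀ (v : Fin 4 → ℝ), (∀ i, |v i| ≤ Real.sqrt (10*cd.Cg*(2:ℝ) ^ (-(7:ℝ)*((cd.Ka:ℝ) + 1)))) → ∀ l,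
        |cd.ℓ (cd.nx j) l (cd.land j (cd.TP j (cd.S j - 1) u + w') v) - cd.ctr (cd.nx j) l| + cd.β j l ≤
          cd.rad (cd.nx j) l - cd.s (cd.nx j) l :=
  (hV.2.2.2 j hj).2.2.2.2.2.2.2.1

/-- The `ΛX j` clause (projection factor × frame transport from node `0` to the last sub-step). [folklore] -/
theorem ΛX_clause (hV : cd.Valid) (hj : j ≤ cd.N₀) : (1 + cd.bb j * (cd.mT j (cd.S j - 1) + cd.Sp j (cd.S j - 1)) ^ 2 * cd.Nσ j / cd.γ j) *
    (cd.NCi j 0 * (∏ u ∈ Finset.Ico 0 (cd.S j - 1), (1 + cd.κB j u)) *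
      (cd.ρO j (cd.S j - 1) - cd.EO j (cd.S j - 1))) * cd.L1 j (cd.S j - 1) ≤ cd.ΛX j :=
  (hV.2.2.2 j hj).2.2.2.2.2.2.2.2.1

/-- `0 ≤ NDL j l` and `NDL · ΛX · dm ≤ β j l`. [folklore] -/
theorem NDL_clause (hV : cd.Valid) (hj : j ≤ cd.N₀) : ∀ l, 0 ≤ cd.NDL j l ∧ cd.NDL j l * cd.ΛX j * cd.dm j ≤ cd.β j l :=
  (hV.2.2.2 j hj).2.2.2.2.2.2.2.2.2.1

/-- The exit clause (module v3): `1/(1 − bb (mC + ρO) h)^2 ≤ L1 j s'` for every sub-step. [folklore] -/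
theorem L1_exit (hV : cd.Valid) (hj : j ≤ cd.N₀) : ∀ s', s' < cd.S j →
    1 / (1 - cd.bb j * (cd.mC j s' + cd.ρO j s') * cd.h j s') ^ 2 ≤ cd.L1 j s' :=
  (hV.2.2.2 j hj).2.2.2.2.2.2.2.2.2.2

end Readouts

end Summit.NavierStokesRegularity.NavierStokesRegularity.Theorems.TaylorModelReadout.G4

end
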